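import Mathlib
import HarnessLib
import Summits.ValiantsHypothesis.ValiantsHypothesis.Theses.MonotoneRestoration
import Literature.Computability.AlgebraicComplexity.ArithCircuit
import Literature.Computability.AlgebraicComplexity.ArithCircuitProofs
import Literature.Computability.AlgebraicComplexity.MonotoneStructure
import Literature.Computability.AlgebraicComplexity.PermanentIrreducible
import Literature.ModelTheory.FiniteModelTheory.CkEquiv
import Summits.ValiantsHypothesis.ValiantsHypothesis.Theorems.MonotoneRestorationMonotoneRestorationQPCosetCount
import Summits.ValiantsHypothesis.ValiantsHypothesis.Theorems.MonotoneRestorationMonotoneRestorationQPSymmetricLB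
import Summits.ValiantsHypothesis.ValiantsHypothesis.Theorems.MonotoneRestorationMonotoneRestorationQPSupportSymmetrisation
import Summits.ValiantsHypothesis.ValiantsHypothesis.Theorems.MonotoneRestorationMonotoneRestorationQPSparseRegime
import Summits.ValiantsHypothesis.ValiantsHypothesis.Theorems.MonotoneRestorationMonotoneRestorationQPBeta
import Literature.Computability.AlgebraicComplexity.SymmetricArithCircuit
import Literature.Computability.AlgebraicComplexity.DawarWilsenach2025Proofs
import Literature.GroupTheory.PermutationGroups.SmallIndexSubgroups
import Summits.ValiantsHypothesis.ValiantsHypothesis.Theorems.MonotoneRestorationQP.Negative.LoadBearing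
import Summits.ValiantsHypothesis.ValiantsHypothesis.Theorems.MonotoneRestorationMonotoneRestorationQPPermSupportCount

/-! TTRL-lite variant V18953 of stmt-ValiantsHypothesis-15886 -/

-- `Summit.ValiantsHypothesis.ValiantsHypothesis.…` is the tree's mandated single-conjunct layout
-- (Sub = Summit), so the duplicated namespace component is intended.
set_option linter.dupNamespace false

namespace Summit.ValiantsHypothesis.ValiantsHypothesis.Theorems

open Summit.ValiantsHypothesis.ValiantsHypothesis.Theses.MonotoneRestoration
open Literature.Computability.AlgebraicComplexity

/-- **TTRL-lite variant V18953** (`drop_hyp`: the nonvanishing hypothesis `p * q ≠ 0` of the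
circuit-free kernel is dropped) of `stub_mulGate_children_extend`
(item `stmt-ValiantsHypothesis-15886`) is FALSE: with `q = 0` the product `p * q = 0` has empty
support, so the extension hypothesis holds vacuously, while for `p = 1`, `f = 0` the conclusion asks
for a shift of `0 ∈ (1 : MvPolynomial _ ℝ≥0).support` into `(0 : MvPolynomial _ ℝ≥0).support = ∅`.
The witness already lives at `n = 0`.  This pins the nonvanishing hypothesis `hP0 : C.eval P ≠ 0`
of the stub as load-bearing. [folklore] -/
theorem stub_mulGate_children_extend_var18953_false :
    ¬ (∀ (n : ℕ) (p q f : MvPolynomial (Fin n × Fin n) NNReal),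
        (∃ μ : (Fin n × Fin n) →₀ ℕ, ∀ m ∈ (p * q).support, m + μ ∈ f.support) →
        ∃ μ : (Fin n × Fin n) →₀ ℕ, ∀ m ∈ p.support, m + μ ∈ f.support) := by
  intro h
  obtain ⟨μ, hμ⟩ := h 0 1 0 0 ⟨0, fun m hm => by simp at hm⟩
  have h1 : (0 : (Fin 0 × Fin 0) →₀ ℕ) ∈ (1 : MvPolynomial (Fin 0 × Fin 0) NNReal).support := by
    rw [MvPolynomial.mem_support_iff, MvPolynomial.coeff_one, if_pos rfl]
    exact one_ne_zero
  have h2 := hμ 0 h1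
  simp at h2

end Summit.ValiantsHypothesis.ValiantsHypothesis.Theorems
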